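import Literature.NumberTheory.PAdicHodge.BmaxPlusTDivisibilityAllPrimes
import Literature.NumberTheory.PAdicHodge.BmaxPlusTDivP
import HarnessLib

/-!
# The sharp form of Fontaine's lemma: `(A_max)^{φ=p} ∩ ker θ = ℤ_p · t/p` (`p` odd)

Topic `Literature/NumberTheory/PAdicHodge`; namespace `Literature.NumberTheory.PAdicHodge`. THEOREMS ONLY (no definition, no named
fact, no instance, no `sorry`). `BmaxPlusTDivP` showed `t = p·t'` in Colmez's `A_max = B_max⁺(F)` with `t' ∈ (A_max)^{φ=p} ∩ ker θ` and `t ∤ t'`;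
`BmaxPlusTDivisibilityAllPrimes` showed `φx = px ∧ θx = 0 ⇒ p²x = ι(λ)t`. Here the two are combined into the EQUALITY:

* `exists_natCast_mul_eq_zpToAinf_mul_of_tBmax_eq` — `p·x = ι(λ)·t'` (all `p`);
* `uDivXi_not_mem_span_p_xi` — for `p` odd, `u/ξ ∉ (p, ξ)` (`‖(u/ξ)‾♯‖^{p−1} = ‖p‖`, so `> ‖p‖`), hence `not_natCast_dvd_of_tBmax_eq_natCast_mul` —
  **`t' ∉ p·A_max`** (`t/p² ∉ A_max`);
* ★★ `eq_zpToAinf_mul_of_tBmax_eq_natCast_mul` / `frobBmaxPlus_eq_and_theta_eq_zero_iff_exists_eq_zpToAinf_mul` — **for `p` odd,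
  `φ(x) = p·x ∧ θ(x) = 0 ↔ x = ι(μ)·t'` for a (unique) `μ ∈ ℤ_p`**: `(A_max)^{φ=p} ∩ ker θ` is the free `ℤ_p`-line spanned by `t' = t/p`.

(For `p = 2` one has `u/ξ ∈ (2, ξ)`, `t/4 ∈ A_max`, and the generator is smaller; not treated.) φ-road of line `kato_lever` (crux K★
`stmt-BirchSwinnertonDyer-22226`, memo `Cruxes/StarredOptimalManinUnitFiveSeven/Lines/kato-lever-K2-tdiv-g25.md`). Infrastructure only: BSD / K★ are
not proved by any of this.

## References
* [FontaineAsterisque223III] J.-M. Fontaine, *Le corps des périodes p-adiques*, Astérisque 223 (1994), Exp. III Th. 5.3.7, §5.2.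
* [Colmez1998Annals] P. Colmez, *Théorie d'Iwasawa des représentations de de Rham d'un corps local*, Ann. of Math. 148 (1998), §III.3.
-/

noncomputable section

open WittVector Field ValuativeRel Polynomial Finset
open Literature.AlgebraicGeometry.Resolution

namespace Literature.NumberTheory.PAdicHodge

open Literature.NumberTheory.GaloisRepresentations
open Literature.NumberTheory.GaloisRepresentations.IsNonarchimedeanLocalField

variable {F : Type} [Field F] [ValuativeRel F] [TopologicalSpace F] [IsNonarchimedeanLocalField F]
  [CharZero F] {p : ℕ} [Fact p.Prime] [Fact (¬ IsUnit (p : integerC F))]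
  [IsAdicComplete (Ideal.span {(p : integerC F)}) (integerC F)]

/-! ### `p·x = λ·t'` -/

/-- **`p·x = ι(λ)·t'`** for every `x ∈ (A_max)^{φ=p} ∩ ker θ` and any `t'` with `t = p·t'` (Fontaine's lemma `p²x = ι(λ)t` and `p` regular).
[cite: FontaineAsterisque223III, Exp. III Th. 5.3.7] -/
theorem exists_natCast_mul_eq_zpToAinf_mul_of_tBmax_eq (hF : Function.Surjective (fontaineTheta (integerC F) p)) {t' : BmaxPlus F p}
    (ht : tBmax (F := F) (p := p) = (p : BmaxPlus F p) * t') {x : BmaxPlus F p}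
    (hx : frobBmaxPlus F p x = (p : BmaxPlus F p) * x) (hθ : thetaBmaxPlus F p x = 0) :
    ∃ lam : ℤ_[p], (p : BmaxPlus F p) * x = ainfToBmaxPlus F p (zpToAinf lam) * t' := by
  obtain ⟨lam, h⟩ := exists_sq_mul_eq_zpToAinf_mul_tBmax' hF hx hθ
  refine ⟨lam, sub_eq_zero.1 (eq_zero_of_natCast_mul_eq_zero' hF ?_)⟩
  rw [mul_sub, ← mul_assoc, ← pow_two, h, ht]; ring

/-! ### `t' ∉ p·A_max` for `p` odd -/

/-- **For `p` odd, `u/ξ ∉ (p, ξ)𝔸_inf`**: modulo `p`, `‖(u/ξ)‾♯‖^{p−1} = ‖(ε−1)♯‖^{p−1}/‖p‖^{p−1} = ‖p‖`, so `‖(u/ξ)‾♯‖ > ‖p‖ = ‖(p♭)♯‖` when `p − 1 ≥ 2`.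
[cite: FontaineAsterisque223III, Exp. II §1.5.4] -/
theorem uDivXi_not_mem_span_p_xi (hp : p ≠ 2) : (uDivXi : Ainf (p := p) F) ∉ Ideal.span {(p : Ainf (p := p) F), xi} := by
  have hP := (Fact.out : p.Prime)
  intro hmem
  -- modulo `p`: `ε − 1 = p♭ · w̄` and `w̄ ∈ p♭ 𝒪♭`
  rw [span_p_xi_eq] at hmem
  obtain ⟨a, b, hab⟩ := Ideal.mem_span_pair.1 hmem
  have h1 : WittVector.constantCoeff (uDivXi : Ainf (p := p) F) = pFlat * WittVector.constantCoeff b := by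
    have h := congrArg WittVector.constantCoeff hab
    rw [map_add, map_mul, map_mul, map_natCast, CharP.cast_eq_zero, mul_zero, zero_add, WittVector.constantCoeff_apply (teichmuller p pFlat),
      teichmuller_coeff_zero] at h
    rw [← h, mul_comm]
  have h2 : (eps : PreTilt (integerC F) p) - 1 = pFlat * pFlat * WittVector.constantCoeff b := by
    rw [← constantCoeff_uAinf (F := F) (p := p), ← xi_mul_uDivXi, map_mul, constantCoeff_xi, h1, mul_assoc]
  -- norms: `‖(ε−1)♯‖ ≤ ‖p‖²`, contradicting `‖(ε−1)♯‖^{p−1} = ‖p‖^p` for `p ≥ 3`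
  have hle : ‖((PreTilt.untilt ((eps : PreTilt (integerC F) p) - 1) : integerC F) : CompletedAlgClosure F)‖ ≤ ‖(p : CompletedAlgClosure F)‖ ^ 2 := by
    rw [h2, map_mul, map_mul, Subring.coe_mul, Subring.coe_mul, norm_mul, norm_mul, untilt_pFlat, coe_natCast_integerC, ← pow_two]
    exact mul_le_of_le_one_right (pow_nonneg (norm_nonneg _) _) (norm_coe_integerC_le _)
  have hA := norm_untilt_eps_sub_one_pow (F := F) (p := p)
  have hp0 : 0 < ‖(p : CompletedAlgClosure F)‖ := norm_pos_iff.2 (natCast_C_ne_zero hP.ne_zero)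
  have hlt : ‖(p : CompletedAlgClosure F)‖ < 1 := norm_natCast_C_lt_one'
  have h3 : ‖(p : CompletedAlgClosure F)‖ ^ p ≤ (‖(p : CompletedAlgClosure F)‖ ^ 2) ^ (p - 1) := by
    rw [← hA]; exact pow_le_pow_left₀ (norm_nonneg _) hle _
  rw [← pow_mul] at h3
  have h4 : (‖(p : CompletedAlgClosure F)‖) ^ (2 * (p - 1)) < ‖(p : CompletedAlgClosure F)‖ ^ p :=
    pow_lt_pow_right_of_lt_one₀ hp0 hlt (by have := hP.two_le; omega)
  exact absurd (h3.trans_lt h4) (lt_irrefl _)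

set_option maxHeartbeats 1600000 in
set_option synthInstance.maxHeartbeats 400000 in
/-- **`(ξ/p)·G ∈ p·A_max ⇒ G ∈ p·A_max`** (`ξ/p` is a non-zero-divisor modulo `p`, `BmaxPlusKerTheta.mem_span_pow_of_omegaB_mul_mem`, on the completion).
[cite: Colmez1998Annals, §III.2] -/
theorem exists_eq_natCast_mul_of_omegaB_mul_eq {G H : BmaxPlus F p}
    (h : algebraMap (bmaxZero F p) (BmaxPlus F p) omegaB * G = (p : BmaxPlus F p) * H) : ∃ G' : BmaxPlus F p, G = (p : BmaxPlus F p) * G' := by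
  have hp : PrincipalCompletion.xiHat (Ideal.span {(p : bmaxZero F p)}) (p : bmaxZero F p) = (p : BmaxPlus F p) :=
    map_natCast (algebraMap (bmaxZero F p) (BmaxPlus F p)) p
  have key := (PrincipalCompletion.evalₐ_eq_zero_iff (I := Ideal.span {(p : bmaxZero F p)}) rfl G 1)
  rw [hp] at key
  suffices h0 : AdicCompletion.evalₐ (Ideal.span {(p : bmaxZero F p)}) 1 G = 0 by
    obtain ⟨G', hG'⟩ := key.1 h0
    exact ⟨G', by rw [hG', pow_one]⟩
  obtain ⟨y, hy⟩ := Ideal.Quotient.mk_surjective (AdicCompletion.evalₐ (Ideal.span {(p : bmaxZero F p)}) 1 G)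
  obtain ⟨z, hz⟩ := Ideal.Quotient.mk_surjective (AdicCompletion.evalₐ (Ideal.span {(p : bmaxZero F p)}) 1 H)
  have e0 : AdicCompletion.evalₐ (Ideal.span {(p : bmaxZero F p)}) 1 (algebraMap (bmaxZero F p) (BmaxPlus F p) omegaB) =
      Ideal.Quotient.mk _ omegaB := AdicCompletion.evalₐ_of _ 1 _
  have h' := congrArg (AdicCompletion.evalₐ (Ideal.span {(p : bmaxZero F p)}) 1) h
  simp only [map_mul, map_natCast, e0, ← hy, ← hz] at h'
  have e3 : Ideal.Quotient.mk (Ideal.span {(p : bmaxZero F p)} ^ 1) (omegaB * y) =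
      Ideal.Quotient.mk (Ideal.span {(p : bmaxZero F p)} ^ 1) ((p : bmaxZero F p) * z) := by
    simp only [map_mul, map_natCast]; exact h'
  rw [Ideal.Quotient.eq] at e3
  have e4 : omegaB * y ∈ Ideal.span {(p : bmaxZero F p)} ^ 1 := by
    have h5 : (p : bmaxZero F p) * z ∈ Ideal.span {(p : bmaxZero F p)} ^ 1 := by
      rw [pow_one]; exact Ideal.mul_mem_right _ _ (Ideal.mem_span_singleton_self _)
    have e : omegaB * y = (omegaB * y - (p : bmaxZero F p) * z) + (p : bmaxZero F p) * z := by ring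
    rw [e]; exact add_mem e3 h5
  rw [← hy, Ideal.Quotient.eq_zero_iff_mem]
  exact mem_span_pow_of_omegaB_mul_mem 1 e4

set_option maxHeartbeats 1600000 in
/-- ★ **`t' ∉ p·A_max` for `p` odd** (`t/p² ∉ A_max`): if `t = p·t'` and `t' = p·s` then `t = ι(ξ·u/ξ)·v = p·(ξ/p)·ι(u/ξ)·v` gives
`(ξ/p)·ι(u/ξ)·v = p·s`, so `ι(u/ξ) ∈ p·A_max`, i.e. `u/ξ ∈ (p, ξ)` — impossible for `p` odd. [cite: Colmez1998Annals, §III.3]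
[cite: FontaineAsterisque223III, Exp. III §5.2] -/
theorem not_natCast_dvd_of_tBmax_eq_natCast_mul (hF : Function.Surjective (fontaineTheta (integerC F) p)) (hp : p ≠ 2)
    {t' : BmaxPlus F p} (ht : tBmax (F := F) (p := p) = (p : BmaxPlus F p) * t') : ¬ ∃ s : BmaxPlus F p, t' = (p : BmaxPlus F p) * s := by
  rintro ⟨s, hs⟩
  obtain ⟨v, hvu, hvt⟩ := exists_isUnit_tBmax_eq_uAinf_mul' (F := F) (p := p)
  obtain ⟨w, hvw⟩ := hvu.exists_right_inv
  -- `(ξ/p)·(ι(u/ξ)·v) = p·s`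
  have h1 : algebraMap (bmaxZero F p) (BmaxPlus F p) omegaB * (ainfToBmaxPlus F p uDivXi * v) = (p : BmaxPlus F p) * s := by
    refine eq_of_sub_eq_zero (eq_zero_of_natCast_mul_eq_zero' hF ?_)
    have e : tBmax (F := F) (p := p) = (p : BmaxPlus F p) * algebraMap (bmaxZero F p) (BmaxPlus F p) omegaB * ainfToBmaxPlus F p uDivXi * v := by
      rw [hvt, ← xi_mul_uDivXi, map_mul, ainfToBmaxPlus_xi]
    rw [mul_sub]
    linear_combination -e + ht + (p : BmaxPlus F p) * hs
  obtain ⟨G', hG'⟩ := exists_eq_natCast_mul_of_omegaB_mul_eq h1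
  -- `ι(u/ξ) = p·(G'·w)`, so `u/ξ ∈ (p, ξ)`
  have h2 : ainfToBmaxPlus F p uDivXi = (p : BmaxPlus F p) * (G' * w) := by
    calc ainfToBmaxPlus F p uDivXi = ainfToBmaxPlus F p uDivXi * v * w := by rw [mul_assoc, hvw, mul_one]
      _ = (p : BmaxPlus F p) * (G' * w) := by rw [hG']; ring
  have h3 : AdicCompletion.evalₐ (Ideal.span {(p : bmaxZero F p)}) 1 (ainfToBmaxPlus F p uDivXi) = 0 := by
    obtain ⟨y, hy⟩ := Ideal.Quotient.mk_surjective (AdicCompletion.evalₐ (Ideal.span {(p : bmaxZero F p)}) 1 (G' * w))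
    have e := congrArg (AdicCompletion.evalₐ (Ideal.span {(p : bmaxZero F p)}) 1) h2
    simp only [map_mul, map_natCast, ← hy] at e
    rw [e, ← map_natCast (Ideal.Quotient.mk (Ideal.span {(p : bmaxZero F p)} ^ 1)) p, ← map_mul, Ideal.Quotient.eq_zero_iff_mem, pow_one]
    exact Ideal.mul_mem_right _ _ (Ideal.mem_span_singleton_self _)
  rw [evalₐ_ainfToBmaxPlus, Ideal.Quotient.eq_zero_iff_mem, pow_one] at h3
  exact uDivXi_not_mem_span_p_xi hp (mem_span_p_xi_of_algebraMap_mem hF h3)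

/-! ### The line `ℤ_p · t'` -/

set_option maxHeartbeats 1600000 in
/-- ★★ **`(A_max)^{φ=p} ∩ ker θ = ℤ_p · t/p` for `p` odd**: if `t = p·t'`, `φ(x) = p·x` and `θ(x) = 0` then `x = ι(μ)·t'` for some `μ ∈ ℤ_p`
(`p·x = ι(λ)t'`; `λ` must be a non-unit since `t' ∉ pA_max`, so `λ = pμ` and `p` is regular). [cite: FontaineAsterisque223III, Exp. III Th. 5.3.7]
[cite: Colmez1998Annals, §III.3] -/
theorem eq_zpToAinf_mul_of_tBmax_eq_natCast_mul (hF : Function.Surjective (fontaineTheta (integerC F) p)) (hp : p ≠ 2)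
    {t' : BmaxPlus F p} (ht : tBmax (F := F) (p := p) = (p : BmaxPlus F p) * t') {x : BmaxPlus F p}
    (hx : frobBmaxPlus F p x = (p : BmaxPlus F p) * x) (hθ : thetaBmaxPlus F p x = 0) :
    ∃ mu : ℤ_[p], x = ainfToBmaxPlus F p (zpToAinf mu) * t' := by
  obtain ⟨lam, hlam⟩ := exists_natCast_mul_eq_zpToAinf_mul_of_tBmax_eq hF ht hx hθ
  -- `λ` is not a unit
  have hnu : ¬ IsUnit lam := by
    intro hu
    obtain ⟨li, hli⟩ := hu.exists_left_inv
    refine not_natCast_dvd_of_tBmax_eq_natCast_mul hF hp ht ⟨ainfToBmaxPlus F p (zpToAinf li) * x, ?_⟩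
    calc t' = ainfToBmaxPlus F p (zpToAinf (li * lam)) * t' := by rw [hli, map_one, map_one, one_mul]
      _ = ainfToBmaxPlus F p (zpToAinf li) * ((p : BmaxPlus F p) * x) := by rw [map_mul, map_mul, hlam]; ring
      _ = (p : BmaxPlus F p) * (ainfToBmaxPlus F p (zpToAinf li) * x) := by ring
  have hmem : lam ∈ IsLocalRing.maximalIdeal ℤ_[p] := (IsLocalRing.mem_maximalIdeal _).2 hnu
  rw [PadicInt.maximalIdeal_eq_span_p, Ideal.mem_span_singleton'] at hmem
  obtain ⟨mu, rfl⟩ := hmem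
  refine ⟨mu, sub_eq_zero.1 (eq_zero_of_natCast_mul_eq_zero' hF ?_)⟩
  rw [mul_sub, hlam, map_mul, map_mul, map_natCast, map_natCast]; ring

/-- ★★ **`(A_max)^{φ=p} ∩ ker θ = ℤ_p · t/p`, iff form** (`p` odd, `t = p·t'`). [cite: FontaineAsterisque223III, Exp. III Th. 5.3.7] -/
theorem frobBmaxPlus_eq_and_theta_eq_zero_iff_exists_eq_zpToAinf_mul (hF : Function.Surjective (fontaineTheta (integerC F) p)) (hp : p ≠ 2)
    {t' : BmaxPlus F p} (ht : tBmax (F := F) (p := p) = (p : BmaxPlus F p) * t') (x : BmaxPlus F p) :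
    (frobBmaxPlus F p x = (p : BmaxPlus F p) * x ∧ thetaBmaxPlus F p x = 0) ↔
      ∃ mu : ℤ_[p], x = ainfToBmaxPlus F p (zpToAinf mu) * t' := by
  refine ⟨fun h => eq_zpToAinf_mul_of_tBmax_eq_natCast_mul hF hp ht h.1 h.2, ?_⟩
  rintro ⟨mu, rfl⟩
  refine ⟨?_, ?_⟩
  · rw [map_mul, frobBmaxPlus_ainfToBmaxPlus, frobenius_zpToAinf, frobBmaxPlus_eq_of_tBmax_eq_natCast_mul hF ht]; ring
  · rw [map_mul, thetaBmaxPlus_eq_zero_of_tBmax_eq_natCast_mul ht, mul_zero]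

end Literature.NumberTheory.PAdicHodge

end
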